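import Summits.Ventures.CertifiedManyBodySolver.Downfold.EmeryBoxesLa214DFTTrueCorners
import Summits.Ventures.CertifiedManyBodySolver.Downfold.EmeryBoxesLa214SOLTrueCorners
import Summits.Ventures.CertifiedManyBodySolver.Downfold.EmeryScaleBoxLa214DFTX0
import Summits.Ventures.CertifiedManyBodySolver.Downfold.EmeryScaleBoxLa214DFTX0125
import Summits.Ventures.CertifiedManyBodySolver.Downfold.EmeryScaleBoxLa214DFTX022
import Summits.Ventures.CertifiedManyBodySolver.Downfold.EmeryScaleBoxLa214SOLX0
import Summits.Ventures.CertifiedManyBodySolver.Downfold.EmeryScaleBoxLa214SOLX0125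
import Summits.Ventures.CertifiedManyBodySolver.Downfold.EmeryScaleBoxLa214SOLX022
import Summits.Ventures.CertifiedManyBodySolver.Downfold.EmeryBoxesLa214V123
import HarnessLib

/-!
# OBJECT E BY Δ_pd LEVEL TAG — BY-NAME TIES to the typed companion of record `emeryBoxLa214v123` (INFL-3to1-B §B.89 (a); router/EMERY-OBJECT-E-BYTAG.tsv)

Venture CertifiedManyBodySolver, cell `pub/hubbard-downfold` (stage S1), seat hubbard-downfold-mod-4 (technique B, g37); namespace
`Summit.Ventures.CertifiedManyBodySolver.Downfold.Emery`. Everything PROVED (0 sorry; `linarith` on the unfolded membership). WHAT THIS IS NOT: a statement about La₂CuO₄ —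
the typed box is SCREENING-GRADE; `U = 0` one-body kinematics; the Δ_pd LEVEL TAG is the box's own annotation (box #18 §OF-RECORD v1.2: «DFT-level» members
{1.74–1.92, 2.80–2.91, 2.61} ⇒ Δ_pd ≤ 2.91; «solver-level» {3.24, 3.25, 3.6, 3.7(–4.0)} ⇒ Δ_pd ≥ 3.24; «sets tagged, never mixed; DFT-level members are one-body inputs for
downfolding/reduction, solver-level members are solver inputs»).

For every member `p` of `emeryBoxLa214v123` (`EmeryBoxesLa214V123.emeryBoxLa214v123_mem_iff`) whose Δ_pd carries the DFT-level tag (`p .DeltaPd ≤ 291/100`) resp. the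
solver-level tag (`81/25 ≤ p .DeltaPd`), the one-band image (object E) of its σ row at the column filling — SHAPE `t′/t = fsRatio … (fermiEnergyOf … ν)` and SCALE
`t_node = scaleT … (xNode …) (xNode …) (fermiEnergyOf … ν)` — lies in the tag window of `EmeryBoxesLa214{DFT,SOL}TrueCorners` / `EmeryScaleBoxLa214{DFT,SOL}X{0,0125,022}`:

| tag | x = 0 (ν = 1/2) | x = 1/8 (ν = 7/16) | x = 0.22 (ν = 39/100) |
|---|---|---|---|
| DFT-level (Δ_pd ≤ 2.91) | R ∈ [-0.2916, -0.189], t ∈ [0.3683, 0.5823] eV | R ∈ [-0.2926, -0.1903], t ∈ [0.3886, 0.6313] eV | R ∈ [-0.2933, -0.191], t ∈ [0.4003, 0.6635] eV |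
| solver-level (Δ_pd ≥ 3.24) | R ∈ [-0.2465, -0.1674], t ∈ [0.3222, 0.4987] eV | R ∈ [-0.2463, -0.1681], t ∈ [0.3353, 0.5272] eV | R ∈ [-0.2462, -0.1685], t ∈ [0.3434, 0.5436] eV |
(whole box of record: R [−0.2916, −0.1674] / [−0.2926, −0.1681] / [−0.2933, −0.1685], t [0.3222, 0.5823] / [0.3353, 0.6313] / [0.3434, 0.6635] eV — `EmeryBoxesLa214TrueCorners`,
`EmeryScaleBoxLa214X{0,0125,022}`.)

Sources: three-band model [HybertsenSchluterChristensen1989, Eq. (1)]; [AndersenEtAl1995, §6]; box #18 La2CuO4-family.md §OF-RECORD v1.2 / v1.23.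
-/

noncomputable section

namespace Summit.Ventures.CertifiedManyBodySolver.Downfold.Emery

open Real Set

/-- **DFT-level tag, x = 0**: for every member of `emeryBoxLa214v123` with DFT-level Δ_pd the one-band Fermi-surface `t′/t` lies in `[-0.2916, -0.189]`. [folklore] -/
theorem emeryBoxLa214v123_DFT_fsRatio_x0 (p : EmeryCoord → ℝ) (hp : emeryBoxLa214v123.Mem p) (htag : p .DeltaPd ≤ (291/100 : ℝ)) :
    fsRatio (p .DeltaPd) (p .tpd) (p .tpp) (p .tppP) (fermiEnergyOf (p .DeltaPd) (p .tpd) (p .tpp) (p .tppP) (1/2 : ℝ)) ∈ Icc (-729/2500 : ℝ) (-189/1000 : ℝ) := by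
  have h := (emeryBoxLa214v123_mem_iff p).1 hp
  push_cast at h
  obtain ⟨h1, h2, h3, h4, h5, h6, h7, h8, -⟩ := h
  exact la214DFTBox_fsRatio_true_x0 ⟨by linarith, htag⟩ ⟨by linarith, by linarith⟩ ⟨by linarith, by linarith⟩ ⟨by linarith, by linarith⟩

/-- **DFT-level tag, x = 0**: for every member of `emeryBoxLa214v123` with DFT-level Δ_pd the velocity-matched one-band `t_node` lies in `[0.3683, 0.5823]` eV. [folklore] -/
theorem emeryBoxLa214v123_DFT_scale_x0 (p : EmeryCoord → ℝ) (hp : emeryBoxLa214v123.Mem p) (htag : p .DeltaPd ≤ (291/100 : ℝ)) :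
    scaleT (p .DeltaPd) (p .tpd) (p .tpp) (p .tppP) (xNode (p .DeltaPd) (p .tpd) (p .tpp) (p .tppP) (fermiEnergyOf (p .DeltaPd) (p .tpd) (p .tpp) (p .tppP) (1/2 : ℝ))) (xNode (p .DeltaPd) (p .tpd) (p .tpp) (p .tppP) (fermiEnergyOf (p .DeltaPd) (p .tpd) (p .tpp) (p .tppP) (1/2 : ℝ))) (fermiEnergyOf (p .DeltaPd) (p .tpd) (p .tpp) (p .tppP) (1/2 : ℝ))
      ∈ Icc (3683/10000 : ℝ) (5823/10000 : ℝ) := by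
  have h := (emeryBoxLa214v123_mem_iff p).1 hp
  push_cast at h
  obtain ⟨h1, h2, h3, h4, h5, h6, h7, h8, -⟩ := h
  have hd := La214DFTX0_scale_corners_decimal
  constructor
  · exact le_trans hd.1 (La214DFTX0_scale_floor ⟨by linarith, htag⟩ ⟨by linarith, by linarith⟩ ⟨by linarith, by linarith⟩ ⟨by linarith, by linarith⟩)
  · exact le_trans (La214DFTX0_scale_ceiling ⟨by linarith, htag⟩ ⟨by linarith, by linarith⟩ ⟨by linarith, by linarith⟩ ⟨by linarith, by linarith⟩) hd.2

/-- **DFT-level tag, x = 1/8**: for every member of `emeryBoxLa214v123` with DFT-level Δ_pd the one-band Fermi-surface `t′/t` lies in `[-0.2926, -0.1903]`. [folklore] -/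
theorem emeryBoxLa214v123_DFT_fsRatio_x0125 (p : EmeryCoord → ℝ) (hp : emeryBoxLa214v123.Mem p) (htag : p .DeltaPd ≤ (291/100 : ℝ)) :
    fsRatio (p .DeltaPd) (p .tpd) (p .tpp) (p .tppP) (fermiEnergyOf (p .DeltaPd) (p .tpd) (p .tpp) (p .tppP) (7/16 : ℝ)) ∈ Icc (-1463/5000 : ℝ) (-1903/10000 : ℝ) := by
  have h := (emeryBoxLa214v123_mem_iff p).1 hp
  push_cast at h
  obtain ⟨h1, h2, h3, h4, h5, h6, h7, h8, -⟩ := h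
  exact la214DFTBox_fsRatio_true_x0125 ⟨by linarith, htag⟩ ⟨by linarith, by linarith⟩ ⟨by linarith, by linarith⟩ ⟨by linarith, by linarith⟩

/-- **DFT-level tag, x = 1/8**: for every member of `emeryBoxLa214v123` with DFT-level Δ_pd the velocity-matched one-band `t_node` lies in `[0.3886, 0.6313]` eV. [folklore] -/
theorem emeryBoxLa214v123_DFT_scale_x0125 (p : EmeryCoord → ℝ) (hp : emeryBoxLa214v123.Mem p) (htag : p .DeltaPd ≤ (291/100 : ℝ)) :
    scaleT (p .DeltaPd) (p .tpd) (p .tpp) (p .tppP) (xNode (p .DeltaPd) (p .tpd) (p .tpp) (p .tppP) (fermiEnergyOf (p .DeltaPd) (p .tpd) (p .tpp) (p .tppP) (7/16 : ℝ))) (xNode (p .DeltaPd) (p .tpd) (p .tpp) (p .tppP) (fermiEnergyOf (p .DeltaPd) (p .tpd) (p .tpp) (p .tppP) (7/16 : ℝ))) (fermiEnergyOf (p .DeltaPd) (p .tpd) (p .tpp) (p .tppP) (7/16 : ℝ))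
      ∈ Icc (3886/10000 : ℝ) (6313/10000 : ℝ) := by
  have h := (emeryBoxLa214v123_mem_iff p).1 hp
  push_cast at h
  obtain ⟨h1, h2, h3, h4, h5, h6, h7, h8, -⟩ := h
  have hd := La214DFTX0125_scale_corners_decimal
  constructor
  · exact le_trans hd.1 (La214DFTX0125_scale_floor ⟨by linarith, htag⟩ ⟨by linarith, by linarith⟩ ⟨by linarith, by linarith⟩ ⟨by linarith, by linarith⟩)
  · exact le_trans (La214DFTX0125_scale_ceiling ⟨by linarith, htag⟩ ⟨by linarith, by linarith⟩ ⟨by linarith, by linarith⟩ ⟨by linarith, by linarith⟩) hd.2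

/-- **DFT-level tag, x = 0.22**: for every member of `emeryBoxLa214v123` with DFT-level Δ_pd the one-band Fermi-surface `t′/t` lies in `[-0.2933, -0.191]`. [folklore] -/
theorem emeryBoxLa214v123_DFT_fsRatio_x022 (p : EmeryCoord → ℝ) (hp : emeryBoxLa214v123.Mem p) (htag : p .DeltaPd ≤ (291/100 : ℝ)) :
    fsRatio (p .DeltaPd) (p .tpd) (p .tpp) (p .tppP) (fermiEnergyOf (p .DeltaPd) (p .tpd) (p .tpp) (p .tppP) (39/100 : ℝ)) ∈ Icc (-2933/10000 : ℝ) (-191/1000 : ℝ) := by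
  have h := (emeryBoxLa214v123_mem_iff p).1 hp
  push_cast at h
  obtain ⟨h1, h2, h3, h4, h5, h6, h7, h8, -⟩ := h
  exact la214DFTBox_fsRatio_true_x022 ⟨by linarith, htag⟩ ⟨by linarith, by linarith⟩ ⟨by linarith, by linarith⟩ ⟨by linarith, by linarith⟩

/-- **DFT-level tag, x = 0.22**: for every member of `emeryBoxLa214v123` with DFT-level Δ_pd the velocity-matched one-band `t_node` lies in `[0.4003, 0.6635]` eV. [folklore] -/
theorem emeryBoxLa214v123_DFT_scale_x022 (p : EmeryCoord → ℝ) (hp : emeryBoxLa214v123.Mem p) (htag : p .DeltaPd ≤ (291/100 : ℝ)) :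
    scaleT (p .DeltaPd) (p .tpd) (p .tpp) (p .tppP) (xNode (p .DeltaPd) (p .tpd) (p .tpp) (p .tppP) (fermiEnergyOf (p .DeltaPd) (p .tpd) (p .tpp) (p .tppP) (39/100 : ℝ))) (xNode (p .DeltaPd) (p .tpd) (p .tpp) (p .tppP) (fermiEnergyOf (p .DeltaPd) (p .tpd) (p .tpp) (p .tppP) (39/100 : ℝ))) (fermiEnergyOf (p .DeltaPd) (p .tpd) (p .tpp) (p .tppP) (39/100 : ℝ))
      ∈ Icc (4003/10000 : ℝ) (6635/10000 : ℝ) := by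
  have h := (emeryBoxLa214v123_mem_iff p).1 hp
  push_cast at h
  obtain ⟨h1, h2, h3, h4, h5, h6, h7, h8, -⟩ := h
  have hd := La214DFTX022_scale_corners_decimal
  constructor
  · exact le_trans hd.1 (La214DFTX022_scale_floor ⟨by linarith, htag⟩ ⟨by linarith, by linarith⟩ ⟨by linarith, by linarith⟩ ⟨by linarith, by linarith⟩)
  · exact le_trans (La214DFTX022_scale_ceiling ⟨by linarith, htag⟩ ⟨by linarith, by linarith⟩ ⟨by linarith, by linarith⟩ ⟨by linarith, by linarith⟩) hd.2

/-- **solver-level tag, x = 0**: for every member of `emeryBoxLa214v123` with solver-level Δ_pd the one-band Fermi-surface `t′/t` lies in `[-0.2465, -0.1674]`. [folklore] -/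
theorem emeryBoxLa214v123_SOL_fsRatio_x0 (p : EmeryCoord → ℝ) (hp : emeryBoxLa214v123.Mem p) (htag : (81/25 : ℝ) ≤ p .DeltaPd) :
    fsRatio (p .DeltaPd) (p .tpd) (p .tpp) (p .tppP) (fermiEnergyOf (p .DeltaPd) (p .tpd) (p .tpp) (p .tppP) (1/2 : ℝ)) ∈ Icc (-493/2000 : ℝ) (-837/5000 : ℝ) := by
  have h := (emeryBoxLa214v123_mem_iff p).1 hp
  push_cast at h
  obtain ⟨h1, h2, h3, h4, h5, h6, h7, h8, -⟩ := h
  exact la214SOLBox_fsRatio_true_x0 ⟨htag, by linarith⟩ ⟨by linarith, by linarith⟩ ⟨by linarith, by linarith⟩ ⟨by linarith, by linarith⟩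

/-- **solver-level tag, x = 0**: for every member of `emeryBoxLa214v123` with solver-level Δ_pd the velocity-matched one-band `t_node` lies in `[0.3222, 0.4987]` eV. [folklore] -/
theorem emeryBoxLa214v123_SOL_scale_x0 (p : EmeryCoord → ℝ) (hp : emeryBoxLa214v123.Mem p) (htag : (81/25 : ℝ) ≤ p .DeltaPd) :
    scaleT (p .DeltaPd) (p .tpd) (p .tpp) (p .tppP) (xNode (p .DeltaPd) (p .tpd) (p .tpp) (p .tppP) (fermiEnergyOf (p .DeltaPd) (p .tpd) (p .tpp) (p .tppP) (1/2 : ℝ))) (xNode (p .DeltaPd) (p .tpd) (p .tpp) (p .tppP) (fermiEnergyOf (p .DeltaPd) (p .tpd) (p .tpp) (p .tppP) (1/2 : ℝ))) (fermiEnergyOf (p .DeltaPd) (p .tpd) (p .tpp) (p .tppP) (1/2 : ℝ))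
      ∈ Icc (3222/10000 : ℝ) (4987/10000 : ℝ) := by
  have h := (emeryBoxLa214v123_mem_iff p).1 hp
  push_cast at h
  obtain ⟨h1, h2, h3, h4, h5, h6, h7, h8, -⟩ := h
  have hd := La214SOLX0_scale_corners_decimal
  constructor
  · exact le_trans hd.1 (La214SOLX0_scale_floor ⟨htag, by linarith⟩ ⟨by linarith, by linarith⟩ ⟨by linarith, by linarith⟩ ⟨by linarith, by linarith⟩)
  · exact le_trans (La214SOLX0_scale_ceiling ⟨htag, by linarith⟩ ⟨by linarith, by linarith⟩ ⟨by linarith, by linarith⟩ ⟨by linarith, by linarith⟩) hd.2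

/-- **solver-level tag, x = 1/8**: for every member of `emeryBoxLa214v123` with solver-level Δ_pd the one-band Fermi-surface `t′/t` lies in `[-0.2463, -0.1681]`. [folklore] -/
theorem emeryBoxLa214v123_SOL_fsRatio_x0125 (p : EmeryCoord → ℝ) (hp : emeryBoxLa214v123.Mem p) (htag : (81/25 : ℝ) ≤ p .DeltaPd) :
    fsRatio (p .DeltaPd) (p .tpd) (p .tpp) (p .tppP) (fermiEnergyOf (p .DeltaPd) (p .tpd) (p .tpp) (p .tppP) (7/16 : ℝ)) ∈ Icc (-2463/10000 : ℝ) (-1681/10000 : ℝ) := by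
  have h := (emeryBoxLa214v123_mem_iff p).1 hp
  push_cast at h
  obtain ⟨h1, h2, h3, h4, h5, h6, h7, h8, -⟩ := h
  exact la214SOLBox_fsRatio_true_x0125 ⟨htag, by linarith⟩ ⟨by linarith, by linarith⟩ ⟨by linarith, by linarith⟩ ⟨by linarith, by linarith⟩

/-- **solver-level tag, x = 1/8**: for every member of `emeryBoxLa214v123` with solver-level Δ_pd the velocity-matched one-band `t_node` lies in `[0.3353, 0.5272]` eV. [folklore] -/
theorem emeryBoxLa214v123_SOL_scale_x0125 (p : EmeryCoord → ℝ) (hp : emeryBoxLa214v123.Mem p) (htag : (81/25 : ℝ) ≤ p .DeltaPd) :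
    scaleT (p .DeltaPd) (p .tpd) (p .tpp) (p .tppP) (xNode (p .DeltaPd) (p .tpd) (p .tpp) (p .tppP) (fermiEnergyOf (p .DeltaPd) (p .tpd) (p .tpp) (p .tppP) (7/16 : ℝ))) (xNode (p .DeltaPd) (p .tpd) (p .tpp) (p .tppP) (fermiEnergyOf (p .DeltaPd) (p .tpd) (p .tpp) (p .tppP) (7/16 : ℝ))) (fermiEnergyOf (p .DeltaPd) (p .tpd) (p .tpp) (p .tppP) (7/16 : ℝ))
      ∈ Icc (3353/10000 : ℝ) (5272/10000 : ℝ) := by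
  have h := (emeryBoxLa214v123_mem_iff p).1 hp
  push_cast at h
  obtain ⟨h1, h2, h3, h4, h5, h6, h7, h8, -⟩ := h
  have hd := La214SOLX0125_scale_corners_decimal
  constructor
  · exact le_trans hd.1 (La214SOLX0125_scale_floor ⟨htag, by linarith⟩ ⟨by linarith, by linarith⟩ ⟨by linarith, by linarith⟩ ⟨by linarith, by linarith⟩)
  · exact le_trans (La214SOLX0125_scale_ceiling ⟨htag, by linarith⟩ ⟨by linarith, by linarith⟩ ⟨by linarith, by linarith⟩ ⟨by linarith, by linarith⟩) hd.2

/-- **solver-level tag, x = 0.22**: for every member of `emeryBoxLa214v123` with solver-level Δ_pd the one-band Fermi-surface `t′/t` lies in `[-0.2462, -0.1685]`. [folklore] -/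
theorem emeryBoxLa214v123_SOL_fsRatio_x022 (p : EmeryCoord → ℝ) (hp : emeryBoxLa214v123.Mem p) (htag : (81/25 : ℝ) ≤ p .DeltaPd) :
    fsRatio (p .DeltaPd) (p .tpd) (p .tpp) (p .tppP) (fermiEnergyOf (p .DeltaPd) (p .tpd) (p .tpp) (p .tppP) (39/100 : ℝ)) ∈ Icc (-1231/5000 : ℝ) (-337/2000 : ℝ) := by
  have h := (emeryBoxLa214v123_mem_iff p).1 hp
  push_cast at h
  obtain ⟨h1, h2, h3, h4, h5, h6, h7, h8, -⟩ := h
  exact la214SOLBox_fsRatio_true_x022 ⟨htag, by linarith⟩ ⟨by linarith, by linarith⟩ ⟨by linarith, by linarith⟩ ⟨by linarith, by linarith⟩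

/-- **solver-level tag, x = 0.22**: for every member of `emeryBoxLa214v123` with solver-level Δ_pd the velocity-matched one-band `t_node` lies in `[0.3434, 0.5436]` eV. [folklore] -/
theorem emeryBoxLa214v123_SOL_scale_x022 (p : EmeryCoord → ℝ) (hp : emeryBoxLa214v123.Mem p) (htag : (81/25 : ℝ) ≤ p .DeltaPd) :
    scaleT (p .DeltaPd) (p .tpd) (p .tpp) (p .tppP) (xNode (p .DeltaPd) (p .tpd) (p .tpp) (p .tppP) (fermiEnergyOf (p .DeltaPd) (p .tpd) (p .tpp) (p .tppP) (39/100 : ℝ))) (xNode (p .DeltaPd) (p .tpd) (p .tpp) (p .tppP) (fermiEnergyOf (p .DeltaPd) (p .tpd) (p .tpp) (p .tppP) (39/100 : ℝ))) (fermiEnergyOf (p .DeltaPd) (p .tpd) (p .tpp) (p .tppP) (39/100 : ℝ))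
      ∈ Icc (3434/10000 : ℝ) (5436/10000 : ℝ) := by
  have h := (emeryBoxLa214v123_mem_iff p).1 hp
  push_cast at h
  obtain ⟨h1, h2, h3, h4, h5, h6, h7, h8, -⟩ := h
  have hd := La214SOLX022_scale_corners_decimal
  constructor
  · exact le_trans hd.1 (La214SOLX022_scale_floor ⟨htag, by linarith⟩ ⟨by linarith, by linarith⟩ ⟨by linarith, by linarith⟩ ⟨by linarith, by linarith⟩)
  · exact le_trans (La214SOLX022_scale_ceiling ⟨htag, by linarith⟩ ⟨by linarith, by linarith⟩ ⟨by linarith, by linarith⟩ ⟨by linarith, by linarith⟩) hd.2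

end Summit.Ventures.CertifiedManyBodySolver.Downfold.Emery
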